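import Summits.ResolutionOfSingularities.ResolutionOfSingularities.Theorems.FrobeniusClosingCampaignW41Core4HahnValuation
import HarnessLib

/-!
# Crux `Steer` (stmt-16345), chain W4.1 / kill test K4.1b: a Kuhlmann-type series with values `p^{-j}`

OURS (campaign `res-hironaka`, rung L, slot W4.1; replaces the role of no printed item; NOT a statement of
the manuscript under review). Second brick of the KERNEL inhabitant of the dim-`≥ 4` Steer core (K4.1b
«ALIVE-BY-KERNEL», seat res-L0-k41). In `Ω = 𝔽_p⟦x^Γ⟧` with `Γ = ℤ[1/p]` (`PInv p`) consider the series
`κ = Σ_{j ≥ 1} x^{e j}`, `e j = j + p^{-R j}`, `R j = j(j+1)/2` (so `R (j+1) = R j + (j+1)`).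

* `tailSer j = Σ_{i > j} x^{e i}` and the identity `tailSer j = x^{e (j+1)} + tailSer (j+1)`;
  `orderTop (tailSer j) = e (j+1)`.
* `zElt j := (tailSer j) ^ (p ^ R j)` lies in `𝔽_p[x, κ]` for every `j` — by induction using ONLY
  `(a - b)^(p^n) = a^(p^n) - b^(p^n)` and `(single a 1)^n = HahnSeries.single (n • a) 1` (no Frobenius of an
  infinite sum is ever computed): `zElt (j+1) = zElt j ^ (p^(j+1)) - x ^ m (j+1)` with
  `m (j+1) = (j+1) p^{R (j+1)} + 1`.
* `orderTop (zElt j) = p^{R j} • e (j+1)`, whose rational value is `(j+1) p^{R j} + p^{-(j+1)}`: the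
  subring `𝔽_p[x, κ]` contains elements whose values have EXACT denominator `p^{j+1}` for every `j`
  (Kuhlmann-type independent defect; cf. F.-V. Kuhlmann, Trans. AMS 356 (2004), Thm 1.1, whose ABSTRACT
  existence statement this explicit series replaces for the datum).

No `Theses.*` / `Cruxes.*` import (chain build rule). All statements are folklore / direct computation.
-/

-- layout-mandated namespace `Summit.<Summit>.<Problem>.…` with Summit = Problem (single-conjunct summit)
set_option linter.dupNamespace false

namespace Summit.ResolutionOfSingularities.ResolutionOfSingularities.Theorems.SwitchingDichotomy.Core4Hahn


variable (p : ℕ) [hp : Fact p.Prime]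

/-- Rational value of `e j`. -/
@[simp] theorem coe_expo (j : ℕ) : ((expo p j : PInv p) : ℚ) = (j : ℚ) + ((p : ℚ) ^ R j)⁻¹ := rfl

omit hp in
/-- Rational value of `one'`. -/
@[simp] theorem coe_one' : ((one' p : PInv p) : ℚ) = 1 := rfl

/-- `0 < p^{-R j} ≤ 1`. -/
theorem inv_pow_R_pos (j : ℕ) : (0 : ℚ) < ((p : ℚ) ^ R j)⁻¹ :=
  inv_pos.mpr (pow_pos (Nat.cast_pos.mpr hp.out.pos) _)

/-- `p^{-R j} ≤ 1`. -/
theorem inv_pow_R_le_one (j : ℕ) : ((p : ℚ) ^ R j)⁻¹ ≤ 1 :=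
  inv_le_one_of_one_le₀ (one_le_pow₀ (by exact_mod_cast hp.out.one_lt.le))

/-- The exponents increase strictly. -/
theorem expo_strictMono : StrictMono (expo p) := by
  refine strictMono_nat_of_lt_succ fun j => ?_
  show ((expo p j : PInv p) : ℚ) < (expo p (j + 1) : PInv p)
  simp only [coe_expo, Nat.cast_add, Nat.cast_one]
  have h1 := inv_pow_R_le_one p j
  have h2 := inv_pow_R_pos p (j + 1)
  linarith

/-- The exponents are positive. -/
theorem expo_pos (j : ℕ) : 0 < expo p j := by
  show (0 : ℚ) < (expo p j : PInv p)
  simp only [coe_expo]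
  have := inv_pow_R_pos p j
  positivity

omit hp in
/-- `one'` is positive. -/
theorem one'_pos : 0 < one' p := by
  show (0 : ℚ) < (one' p : PInv p)
  simp

/-! ## The tails `tailSer j = Σ_{i > j} x^{e i}` -/

/-- Coefficients of the tail on its support. -/
theorem coeff_tailSer_of_mem {j : ℕ} {g : PInv p} (h : g ∈ tailSupp p j) : (tailSer p j).coeff g = 1 := by
  classical
  show (if g ∈ tailSupp p j then (1 : ZMod p) else 0) = 1
  rw [if_pos h]

/-- Coefficients of the tail off its support. -/
theorem coeff_tailSer_of_not_mem {j : ℕ} {g : PInv p} (h : g ∉ tailSupp p j) : (tailSer p j).coeff g = 0 := by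
  classical
  show (if g ∈ tailSupp p j then (1 : ZMod p) else 0) = 0
  rw [if_neg h]

/-- Membership in the tail support. -/
theorem mem_tailSupp_iff {j : ℕ} {g : PInv p} : g ∈ tailSupp p j ↔ ∃ i, j < i ∧ expo p i = g := by
  simp [tailSupp]

/-- An exponent `e i` lies in the `j`-th tail support iff `j < i`. -/
theorem expo_mem_tailSupp_iff {j i : ℕ} : expo p i ∈ tailSupp p j ↔ j < i := by
  rw [mem_tailSupp_iff]
  constructor
  · rintro ⟨i', hi', h⟩
    rwa [← (expo_strictMono p).injective h]
  · exact fun h => ⟨i, h, rfl⟩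

/-- Support of the tail. -/
theorem support_tailSer (j : ℕ) : (tailSer p j).support = tailSupp p j := by
  ext g
  rw [HahnSeries.mem_support]
  by_cases h : g ∈ tailSupp p j
  · rw [coeff_tailSer_of_mem p h]
    simp [h]
  · rw [coeff_tailSer_of_not_mem p h]
    simp [h]

/-- The tails are non-zero. -/
theorem tailSer_ne_zero (j : ℕ) : tailSer p j ≠ 0 := by
  intro h
  have : expo p (j + 1) ∈ (tailSer p j).support := by
    rw [support_tailSer, expo_mem_tailSupp_iff]
    exact Nat.lt_succ_self j
  rw [h, HahnSeries.support_zero] at this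
  exact this

/-- `orderTop (tailSer j) = e (j+1)`. -/
theorem orderTop_tailSer (j : ℕ) : (tailSer p j).orderTop = expo p (j + 1) := by
  apply HahnSeries.orderTop_eq_of_le
  · rw [support_tailSer, expo_mem_tailSupp_iff]
    exact Nat.lt_succ_self j
  · intro g hg
    rw [support_tailSer, mem_tailSupp_iff] at hg
    obtain ⟨i, hi, rfl⟩ := hg
    exact (expo_strictMono p).monotone hi

/-- The tail has positive order. -/
theorem orderTop_tailSer_pos (j : ℕ) : 0 < (tailSer p j).orderTop := by
  rw [orderTop_tailSer]
  exact WithTop.coe_pos.mpr (expo_pos p _)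

/-- **The peeling identity** `tailSer j = x^{e (j+1)} + tailSer (j+1)`. -/
theorem tailSer_eq_single_add (j : ℕ) : tailSer p j = HahnSeries.single (expo p (j + 1)) 1 + tailSer p (j + 1) := by
  ext g
  rw [HahnSeries.coeff_add, HahnSeries.coeff_single]
  by_cases h1 : g = expo p (j + 1)
  · subst h1
    rw [coeff_tailSer_of_mem p ((expo_mem_tailSupp_iff p).mpr (Nat.lt_succ_self j)), if_pos rfl,
      coeff_tailSer_of_not_mem p (fun h => lt_irrefl _ ((expo_mem_tailSupp_iff p).mp h)), add_zero]
  · rw [if_neg h1, zero_add]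
    by_cases h2 : g ∈ tailSupp p (j + 1)
    · rw [coeff_tailSer_of_mem p h2, coeff_tailSer_of_mem p]
      obtain ⟨i, hi, rfl⟩ := (mem_tailSupp_iff p).mp h2
      exact (expo_mem_tailSupp_iff p).mpr (Nat.lt_of_succ_lt hi)
    · rw [coeff_tailSer_of_not_mem p h2, coeff_tailSer_of_not_mem p]
      intro h3
      obtain ⟨i, hi, rfl⟩ := (mem_tailSupp_iff p).mp h3
      rcases Nat.lt_or_ge (j + 1) i with h | h
      · exact h2 ((expo_mem_tailSupp_iff p).mpr h)
      · exact h1 (congrArg (expo p) (le_antisymm h hi))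

/-! ## The elements `zElt j = (tailSer j)^(p^(R j)) ∈ 𝔽_p[x, κ]` -/

/-- `zElt 0 = κ`. -/
theorem zElt_zero : zElt p 0 = kser p := by
  simp [zElt, R, kser]

/-- Exponent bookkeeping: `p^{R (j+1)} • e (j+1) = m (j+1) • 1` in `ℤ[1/p]`. -/
theorem nsmul_expo_succ (j : ℕ) : p ^ R (j + 1) • expo p (j + 1) = mExp p j • one' p := by
  apply Subtype.ext
  rw [AddSubgroupClass.coe_nsmul, AddSubgroupClass.coe_nsmul, coe_expo, coe_one', mExp]
  have hp0 : (p : ℚ) ^ R (j + 1) ≠ 0 := pow_ne_zero _ (Nat.cast_ne_zero.mpr hp.out.ne_zero)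
  simp only [nsmul_eq_mul]
  push_cast
  field_simp

/-- `Ω = HahnSeries _ 𝔽_p` has characteristic `p`. -/
theorem charP_Ω : CharP (Ω p) p := charP_hahnSeries (PInv p) p

/-- **The recursion** `zElt (j+1) = zElt j ^ (p^(j+1)) - x ^ m (j+1)`. -/
theorem zElt_succ (j : ℕ) : zElt p (j + 1) = zElt p j ^ p ^ (j + 1) - xElt p ^ mExp p j := by
  haveI := charP_Ω p
  have h1 : tailSer p (j + 1) = tailSer p j - HahnSeries.single (expo p (j + 1)) 1 := by
    rw [tailSer_eq_single_add p j]; abel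
  have hx : xElt p ^ mExp p j = HahnSeries.single (mExp p j • one' p) 1 := by
    rw [xElt, HahnSeries.single_pow, one_pow]
  rw [zElt, zElt, h1, sub_pow_char_pow, HahnSeries.single_pow, one_pow, nsmul_expo_succ, ← pow_mul,
    ← _root_.pow_add, hx]
  rfl

/-- **`zElt j ∈ 𝔽_p[x, κ]`** for every `j`. -/
theorem zElt_mem_adjoin (j : ℕ) :
    zElt p j ∈ Algebra.adjoin (ZMod p) ({xElt p, kser p} : Set (Ω p)) := by
  induction j with
  | zero =>
    rw [zElt_zero]
    exact Algebra.subset_adjoin (by simp)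
  | succ j ih =>
    rw [zElt_succ]
    exact Subalgebra.sub_mem _ (Subalgebra.pow_mem _ ih _)
      (Subalgebra.pow_mem _ (Algebra.subset_adjoin (by simp)) _)

/-- `orderTop` of a power in the domain `Ω`. [folklore] -/
theorem orderTop_pow_eq (h : Ω p) (n : ℕ) : (h ^ n).orderTop = n • h.orderTop := by
  induction n with
  | zero => simp
  | succ n ih =>
    rw [pow_succ, HahnSeries.orderTop_mul, ih, succ_nsmul]

/-- `zElt j ≠ 0`. -/
theorem zElt_ne_zero (j : ℕ) : zElt p j ≠ 0 := pow_ne_zero _ (tailSer_ne_zero p j)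

/-- **`orderTop (zElt j) = p^{R j} • e (j+1)`.** -/
theorem orderTop_zElt (j : ℕ) : (zElt p j).orderTop = ((p ^ R j • expo p (j + 1) : PInv p) : WithTop (PInv p)) := by
  rw [zElt, orderTop_pow_eq p (tailSer p j), orderTop_tailSer, ← WithTop.coe_nsmul]

/-- The rational value of `orderTop (zElt j)`: `(j+1) p^{R j} + p^{-(j+1)}` — exact denominator `p^{j+1}`. -/
theorem coe_nsmul_expo (j : ℕ) :
    ((p ^ R j • expo p (j + 1) : PInv p) : ℚ) = (j + 1) * (p : ℚ) ^ R j + ((p : ℚ) ^ (j + 1))⁻¹ := by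
  rw [AddSubgroupClass.coe_nsmul, coe_expo, R]
  have hp0 : (p : ℚ) ≠ 0 := (Nat.cast_ne_zero.mpr hp.out.ne_zero)
  simp only [nsmul_eq_mul]
  push_cast
  field_simp
  ring

/-- `orderTop x = 1`. -/
theorem orderTop_xElt : (xElt p).orderTop = ((one' p : PInv p) : WithTop (PInv p)) := by
  rw [xElt, HahnSeries.orderTop_single one_ne_zero]

/-- `x ≠ 0`. -/
theorem xElt_ne_zero : xElt p ≠ 0 := by
  rw [xElt]; exact HahnSeries.single_ne_zero one_ne_zero

/-- `orderTop (x ^ n) = n • 1`. -/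
theorem orderTop_xElt_pow (n : ℕ) : (xElt p ^ n).orderTop = ((n • one' p : PInv p) : WithTop (PInv p)) := by
  rw [orderTop_pow_eq p (xElt p), orderTop_xElt, ← WithTop.coe_nsmul]

/-- `orderTop κ = e 1 > 0`. -/
theorem orderTop_kser : (kser p).orderTop = expo p 1 := orderTop_tailSer p 0

/-- `κ ≠ 0`. -/
theorem kser_ne_zero : kser p ≠ 0 := tailSer_ne_zero p 0

end Summit.ResolutionOfSingularities.ResolutionOfSingularities.Theorems.SwitchingDichotomy.Core4Hahn
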